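import Literature.AlgebraicGeometry.Resolution.PermissibleCentres
import Literature.AlgebraicGeometry.Resolution.SubschemeRegularStalks
import Literature.AlgebraicGeometry.Resolution.ResolutionOfCurves
import Literature.AlgebraicGeometry.Resolution.PrincipalizationOfProp44
import HarnessLib

/-!
# Closed points and regular irreducible curves of `Σ` are permissible centres (CoP1, Prop. 4.4)

Topic: `Literature/AlgebraicGeometry/Resolution`. [CoP1] = Cossart–Piltant, J. Algebra 320
(2008), proof of Prop. 4.2, p. 8 ("let `Y ⊂ X` be a permissible center for `E` (i.e. regular
and contained in `Σ`)") and the algorithm of Prop. 4.4, p. 9: "1- … let `X(i + 1)` be the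
blowing up of `X(i)` along any such singular point. 2- … the blowing up of `X(i)` along any such
non-transverse intersection point. 3- … along any such intersecting curve. 4- If all connected
components of `Σ(i)` are regular …, along any of these components." The centres of the
algorithm are closed points of `Σ` and regular irreducible curves in `Σ`; this file records that
these are permissible centres in the sense used by `IsPermissibleSeq` (reduced closed subset
`Y` with `vanishingIdeal Y` having integral regular subscheme, `Y ⊆ Σ = {ord = μ}`). PROVED:

* `isRegular_subscheme_vanishingIdeal_singleton`, `isIntegral_subscheme_vanishingIdeal_singleton`
  — **the reduced closed point `{x}` of a locally Noetherian scheme is a regular integral closed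
  subscheme** (its only local ring is the residue field `𝒪_{X,x}/𝔪_x`);
* `forall_mem_closeds_singleton_idealOrder_eq` — `{x} ⊆ Σ` when `ord_x J = μ`;
* `isIntegral_subscheme_vanishingIdeal_of_isIrreducible` — an irreducible closed subset with its
  reduced structure is integral (re-export of `isIntegral_subscheme_vanishingIdeal` in the form
  used for the curve centres of steps 3–4).

## Sources

* V. Cossart, O. Piltant, J. Algebra 320 (2008) 1051–1082, proof of Prop. 4.2 and proof of
  Prop. 4.4 (the algorithm), pp. 8–9. [CossartPiltant2008]
-/

noncomputable section

open CategoryTheory AlgebraicGeometry TopologicalSpace IsLocalRing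

namespace Literature.AlgebraicGeometry.Resolution

universe u

open Scheme.IdealSheafData

variable {X : Scheme.{u}}

/-- **The reduced closed point is a regular closed subscheme**: for a closed point `x` of a
locally Noetherian scheme, the subscheme of `vanishingIdeal {x}` is regular — its unique point
has local ring `𝒪_{X,x}/𝔪_x`, a field (`stalkIdeal_vanishingIdeal_singleton`).
[cite: CossartPiltant2008, proof of Prop. 4.4] -/
theorem isRegular_subscheme_vanishingIdeal_singleton [IsLocallyNoetherian X] {x : X}
    (hx : IsClosed ({x} : Set X)) :
    Scheme.IsRegular (vanishingIdeal (⟨{x}, hx⟩ : Closeds X)).subscheme := by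
  refine Scheme.isRegular_subscheme_of_forall _ fun y hy => ?_
  rw [← SetLike.mem_coe, coe_support_vanishingIdeal] at hy
  obtain rfl : y = x := hy
  rw [stalkIdeal_vanishingIdeal_singleton hx]
  letI := Ideal.Quotient.field (maximalIdeal (X.presheaf.stalk y))
  infer_instance

/-- **The reduced closed point is an integral scheme.** [folklore] -/
theorem isIntegral_subscheme_vanishingIdeal_singleton {x : X} (hx : IsClosed ({x} : Set X)) :
    IsIntegral (vanishingIdeal (⟨{x}, hx⟩ : Closeds X)).subscheme :=
  isIntegral_subscheme_vanishingIdeal _ isIrreducible_singleton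

/-- `{x} ⊆ Σ = {ord = μ}` for a point `x` with `ord_x J = μ` (the hypothesis of
`IsPermissibleSeq.cons` for the centre `{x}`). [cite: CossartPiltant2008, proof of Prop. 4.4] -/
theorem forall_mem_closeds_singleton_idealOrder_eq {J : X.IdealSheafData} {μ : ℕ} {x : X}
    (hx : IsClosed ({x} : Set X)) (hord : idealOrder J x = μ) :
    ∀ y ∈ ((⟨{x}, hx⟩ : Closeds X) : Set X), idealOrder J y = μ := by
  intro y hy
  obtain rfl : y = x := hy
  exact hord

/-- **Blowing up a closed point of `Σ` is a permissible step**: for a closed point `x` with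
`ord_x J = μ` of a locally Noetherian scheme and a blowing up `τ` along `vanishingIdeal {x}`,
the data required by `IsPermissibleSeq.cons` hold. [cite: CossartPiltant2008, proof of Prop. 4.4] -/
theorem isPermissibleSeq_cons_singleton [IsLocallyNoetherian X] {X'' X₀ : Scheme.{u}}
    {π : X ⟶ X₀} {J₀ : X₀.IdealSheafData} {μ : ℕ} {J : X.IdealSheafData}
    (h : IsPermissibleSeq π J₀ μ J) {x : X} (hx : IsClosed ({x} : Set X))
    (hord : idealOrder J x = μ) {τ : X'' ⟶ X}
    (hτ : IsBlowup τ (vanishingIdeal (⟨{x}, hx⟩ : Closeds X))) :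
    IsPermissibleSeq (τ ≫ π) J₀ μ
      (controlledTransform τ (vanishingIdeal (⟨{x}, hx⟩ : Closeds X)) J μ) :=
  IsPermissibleSeq.cons τ π J₀ μ J ⟨{x}, hx⟩ h (isIntegral_subscheme_vanishingIdeal_singleton hx)
    (isRegular_subscheme_vanishingIdeal_singleton hx)
    (forall_mem_closeds_singleton_idealOrder_eq hx hord) hτ

/-- **Regular irreducible curves of `Σ` are permissible centres**: an irreducible closed subset
`Y ⊆ Σ` whose reduced subscheme is regular gives the data of `IsPermissibleSeq.cons`.
[cite: CossartPiltant2008, proof of Prop. 4.4] -/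
theorem isPermissibleSeq_cons_of_isIrreducible {X'' X₀ : Scheme.{u}}
    {π : X ⟶ X₀} {J₀ : X₀.IdealSheafData} {μ : ℕ} {J : X.IdealSheafData}
    (h : IsPermissibleSeq π J₀ μ J) {Y : Closeds X} (hirr : IsIrreducible (Y : Set X))
    (hreg : Scheme.IsRegular (vanishingIdeal Y).subscheme)
    (hY : ∀ y ∈ (Y : Set X), idealOrder J y = μ) {τ : X'' ⟶ X}
    (hτ : IsBlowup τ (vanishingIdeal Y)) :
    IsPermissibleSeq (τ ≫ π) J₀ μ (controlledTransform τ (vanishingIdeal Y) J μ) :=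
  IsPermissibleSeq.cons τ π J₀ μ J Y h (isIntegral_subscheme_vanishingIdeal Y hirr) hreg hY hτ

end Literature.AlgebraicGeometry.Resolution

end
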